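import Summits.QuantumFields.YangMills.Theorems.ColdStartUniversalityEntropyTensorizationNonneg
import Summits.QuantumFields.YangMills.Theorems.ColdStartUniversalityLatticeLangevinCarreDuChampDictionary
import Summits.QuantumFields.YangMills.Theorems.ColdStartUniversalityLatticeLangevinWilsonHolleyStroock
import Summits.QuantumFields.YangMills.Theorems.ColdStartUniversalityLatticeLangevinWilsonSemigroupLogSobolev
import Literature.MathematicalPhysics.QuantumFieldTheory.SUNBakryEmeryLogSobolevSmooth
import HarnessLib

/-!
# Route `ColdStartUniversality` (fixed-cut-off package, entropy side): the LOG-SOBOLEV INEQUALITY FOR PRODUCT HAAR MEASURE on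
# `SU(2)^E` in the CSU coordinate-generator language (`β' = 0`), by tensorisation of the one-link Bakry–Émery inequality

Helper file (seat `ym-line-csu-p1`, g22; `--supports stmt-QuantumFields-27363`).  For the SU(2) lattice Langevin dynamics of
Shen–Zhu–Zhu on `(ℤ/L)³` at `β' = 0` the invariant measure is product Haar `μ₀ = wilsonMeasure 0` (`wilsonMeasure_zero_eq_pi`).  For
every `C³` function `f` of the real link coordinates (`F = f∘coords`, `𝓛₀` the SZZ coordinate generator at `β' = 0`):
  ★★ `haar_generatorLogSobolev`:   `(1/2) · Ent_{μ₀}(F²) ≤ −∫ F 𝓛₀f dμ₀`,   `Ent_μ(w) = ∫ w log w dμ − (∫ w dμ) log(∫ w dμ)`,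
the generator-form LOG-SOBOLEV INEQUALITY with constant `1/2` = hypothesis `hLSgen` of g21's `klDiv_map_le_exp_of_generatorLogSobolev`
at `β' = 0`.  Bricks: the one-link Bakry–Émery inequality `Ent_σ(u²) ≤ (4/N)∫Γ(u,u)dσ` (`logSobolev_haar_of_contDiff_one`, g20, `N = 2`)
read in coordinates link by link (`entropy_sq_link_le`, through the affine link chart `exists_linkChart_linear`); n-fold SUB-ADDITIVITY
of the entropy (`EntropyFlow.entropy_pi_le_of_nonneg`) + resampling invariance; the ONE-LINK DICTIONARY `Γ_CSU = 2 Σ_e Gam`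
(`carre_eq_two_mul_sum_Gam`, g21) — together `haar_entropy_sq_le_integral_carre`: `Ent_{μ₀}((g∘coords)²) ≤ ∫ Γ_CSU(g,g) dμ₀` for `C¹`
`g`; and the energy identity `2∫ G 𝓛₀g dμ₀ = −∫ Γ_CSU(g,g) dμ₀` after localisation by a bump.
THEOREMS ONLY, no definition, no sorry.  HONEST FRAMING: RECORD-rung R3 plumbing at FIXED cut-off and `β' = 0` (no Yang–Mills content;
the constant `1/2` is Bakry–Émery's, not sharp); nothing K-uniform; no crux, rung or summit statement is proved; YM mass gap NOT proved.
-/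

set_option autoImplicit false

noncomputable section

namespace Summit.QuantumFields.YangMills.Theorems.ColdStartUniversality

open scoped Matrix ComplexConjugate BigOperators NNReal ENNReal
open MeasureTheory Matrix Complex Finset Function Metric Set
open Literature.MathematicalPhysics.QuantumFieldTheory
open Literature.MathematicalPhysics.QuantumLattice (fundamentalRep fundamentalLatticeRep continuous_fundamentalRep fundamentalRep_apply)

variable {L : ℕ} [NeZero L]

/-! ## §1. The affine link chart `ψ_e^V` and the chain rule -/

open scoped Matrix.Norms.Frobenius in
/-- **The link chart is affine and the chain rule through it.**  For a link `e` there is a real-linear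
`T : M_2(ℂ) →L[ℝ] ℝ^{coords}` (`(T X)_q = [q.1 = e]·(Re/Im X_{ab})`) with `ψ_e^V(X) = T X + (coords V − T ρ(V_e))` for every `V`, hence
`ψ_e^V(ρ(V_e)) = coords V` and, for differentiable `g`, `d(g ∘ ψ_e^V)(ρ(V_e))[H] = dg(coords V)[T H]`; moreover `ψ_e^{update x e t} = ψ_e^x`
and `g ∘ ψ_e^x` is `C¹` when `g` is. [folklore] -/
theorem exists_linkChart_linear (L : ℕ) [NeZero L] (e : Edge 3 L) :
    let coords : GaugeConfig 3 L (Matrix.specialUnitaryGroup (Fin 2) ℂ) → (Edge 3 L × Fin 2 × Fin 2 × Bool → ℝ) :=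
      fun V q => (fun z : ℂ => if q.2.2.2 then z.im else z.re)
        ((fundamentalRep (Fin 2) (V q.1) : Matrix (Fin 2) (Fin 2) ℂ) q.2.1 q.2.2.1)
    let ψ : GaugeConfig 3 L (Matrix.specialUnitaryGroup (Fin 2) ℂ) → Edge 3 L →
        Matrix (Fin (fundamentalLatticeRep 2).N) (Fin (fundamentalLatticeRep 2).N) ℂ → (Edge 3 L × Fin 2 × Fin 2 × Bool → ℝ) :=
      fun V e X q => if q.1 = e then (fun z : ℂ => if q.2.2.2 then z.im else z.re) (X q.2.1 q.2.2.1) else coords V q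
    ∃ T : Matrix (Fin (fundamentalLatticeRep 2).N) (Fin (fundamentalLatticeRep 2).N) ℂ →L[ℝ] (Edge 3 L × Fin 2 × Fin 2 × Bool → ℝ),
      (∀ (V : GaugeConfig 3 L (Matrix.specialUnitaryGroup (Fin 2) ℂ)) X,
        ψ V e X = T X + (coords V - T ((matrixConfig (fundamentalRep (Fin 2)) V : MatrixConfig 3 L (fundamentalLatticeRep 2).N) e))) ∧
      (∀ V : GaugeConfig 3 L (Matrix.specialUnitaryGroup (Fin 2) ℂ),
        ψ V e ((matrixConfig (fundamentalRep (Fin 2)) V : MatrixConfig 3 L (fundamentalLatticeRep 2).N) e) = coords V) := by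
  intro coords ψ
  classical
  set coordOf : (Fin 2 × Fin 2 × Bool) → Matrix (Fin (fundamentalLatticeRep 2).N) (Fin (fundamentalLatticeRep 2).N) ℂ → ℝ :=
    fun p X => (fun z : ℂ => if p.2.2 then z.im else z.re) (X p.1 p.2.1) with hcoordOf
  have hcoord_add : ∀ p (X Y : Matrix (Fin (fundamentalLatticeRep 2).N) (Fin (fundamentalLatticeRep 2).N) ℂ),
      coordOf p (X + Y) = coordOf p X + coordOf p Y := by
    intro p X Y; simp only [hcoordOf, Matrix.add_apply]; split_ifs <;> simp
  have hcoord_smul : ∀ p (r : ℝ) (X : Matrix (Fin (fundamentalLatticeRep 2).N) (Fin (fundamentalLatticeRep 2).N) ℂ),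
      coordOf p (r • X) = r * coordOf p X := by
    intro p r X; simp only [hcoordOf, Matrix.smul_apply, Complex.real_smul]
    split_ifs <;> simp [Complex.mul_re, Complex.mul_im]
  let Tl : Matrix (Fin (fundamentalLatticeRep 2).N) (Fin (fundamentalLatticeRep 2).N) ℂ →ₗ[ℝ] (Edge 3 L × Fin 2 × Fin 2 × Bool → ℝ) :=
    { toFun := fun X q => if q.1 = e then coordOf q.2 X else 0
      map_add' := fun X Y => by
        funext q; simp only [Pi.add_apply]; split_ifs with h
        · exact hcoord_add _ _ _
        · simp
      map_smul' := fun r X => by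
        funext q; simp only [Pi.smul_apply, smul_eq_mul, RingHom.id_apply]; split_ifs with h
        · exact hcoord_smul _ _ _
        · simp }
  let T : Matrix (Fin (fundamentalLatticeRep 2).N) (Fin (fundamentalLatticeRep 2).N) ℂ →L[ℝ] (Edge 3 L × Fin 2 × Fin 2 × Bool → ℝ) :=
    LinearMap.toContinuousLinearMap Tl
  have hT : ∀ X q, T X q = if q.1 = e then coordOf q.2 X else 0 := fun X q => rfl
  have hQe : ∀ V : GaugeConfig 3 L (Matrix.specialUnitaryGroup (Fin 2) ℂ),
      ((matrixConfig (fundamentalRep (Fin 2)) V : MatrixConfig 3 L (fundamentalLatticeRep 2).N) e) =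
        (fundamentalRep (Fin 2) (V e) : Matrix (Fin 2) (Fin 2) ℂ) := fun V => rfl
  refine ⟨T, fun V X => ?_, fun V => ?_⟩
  · funext q
    simp only [Pi.add_apply, Pi.sub_apply, hT]
    by_cases h : q.1 = e
    · simp only [ψ, h, if_true]
      have : coords V q = coordOf q.2 (((matrixConfig (fundamentalRep (Fin 2)) V : MatrixConfig 3 L (fundamentalLatticeRep 2).N) e)) := by
        simp only [coords, hcoordOf, ← h]; rfl
      rw [this]; ring
    · simp only [ψ, h, if_false]; ring
  · funext q
    by_cases h : q.1 = e
    · simp only [ψ, h, if_true, coords, hQe]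
    · simp only [ψ, h, if_false]

/-! ## §2. The one-link log-Sobolev inequality, read in coordinates -/

open scoped Matrix.Norms.Frobenius in
/-- **Per-link log-Sobolev inequality in coordinates.**  For a `C¹` function `g` of the real link coordinates, a configuration
`x ∈ SU(2)^E` and a link `e`, the Haar entropy of `t ↦ g(coords(update x e t))²` is at most `2 ∫ H_e(update x e t) dσ(t)` with
`H_e(V) = Gam(g ∘ ψ_e^V)(ρ(V_e))` the link-`e` Bakry–Émery carré du champ (`logSobolev_haar_of_contDiff_one` for `u = g ∘ ψ_e^x`,
`N = 2`, constant `4/N = 2`; `ψ_e^{update x e t} = ψ_e^x`, `u(ρ t) = g(coords(update x e t))`).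
[cite: BakryGentilLedoux2014, Prop. 5.7.1] [cite: ShenZhuZhuCMP2023, Theorem 4.2 (4.12), β = 0] -/
theorem entropy_sq_link_le (L : ℕ) [NeZero L] {g : (Edge 3 L × Fin 2 × Fin 2 × Bool → ℝ) → ℝ} (hg : ContDiff ℝ 1 g)
    (x : GaugeConfig 3 L (Matrix.specialUnitaryGroup (Fin 2) ℂ)) (e : Edge 3 L) :
    let coords : GaugeConfig 3 L (Matrix.specialUnitaryGroup (Fin 2) ℂ) → (Edge 3 L × Fin 2 × Fin 2 × Bool → ℝ) :=
      fun V q => (fun z : ℂ => if q.2.2.2 then z.im else z.re)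
        ((fundamentalRep (Fin 2) (V q.1) : Matrix (Fin 2) (Fin 2) ℂ) q.2.1 q.2.2.1)
    let ψ : GaugeConfig 3 L (Matrix.specialUnitaryGroup (Fin 2) ℂ) → Edge 3 L →
        Matrix (Fin (fundamentalLatticeRep 2).N) (Fin (fundamentalLatticeRep 2).N) ℂ → (Edge 3 L × Fin 2 × Fin 2 × Bool → ℝ) :=
      fun V e X q => if q.1 = e then (fun z : ℂ => if q.2.2.2 then z.im else z.re) (X q.2.1 q.2.2.1) else coords V q
    (∫ t, g (coords (update x e t)) ^ 2 * Real.log (g (coords (update x e t)) ^ 2)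
        ∂haarProbability (Matrix.specialUnitaryGroup (Fin 2) ℂ)) -
      (∫ t, g (coords (update x e t)) ^ 2 ∂haarProbability (Matrix.specialUnitaryGroup (Fin 2) ℂ)) *
        Real.log (∫ t, g (coords (update x e t)) ^ 2 ∂haarProbability (Matrix.specialUnitaryGroup (Fin 2) ℂ)) ≤
      2 * ∫ t, SUNBakryEmery.Gam (g ∘ ψ (update x e t) e) (g ∘ ψ (update x e t) e)
        ((matrixConfig (fundamentalRep (Fin 2)) (update x e t) : MatrixConfig 3 L (fundamentalLatticeRep 2).N) e)
        ∂haarProbability (Matrix.specialUnitaryGroup (Fin 2) ℂ) := by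
  intro coords ψ
  classical
  obtain ⟨T, hψT', hψQ'⟩ := exists_linkChart_linear L e
  have hψT : ∀ (V : GaugeConfig 3 L (Matrix.specialUnitaryGroup (Fin 2) ℂ)) X, ψ V e X = T X + (coords V -
      T ((matrixConfig (fundamentalRep (Fin 2)) V : MatrixConfig 3 L (fundamentalLatticeRep 2).N) e)) := hψT'
  have hψQ : ∀ V : GaugeConfig 3 L (Matrix.specialUnitaryGroup (Fin 2) ℂ),
      ψ V e ((matrixConfig (fundamentalRep (Fin 2)) V : MatrixConfig 3 L (fundamentalLatticeRep 2).N) e) = coords V := hψQ'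
  have hψupd : ∀ t : Matrix.specialUnitaryGroup (Fin 2) ℂ, ψ (update x e t) e = ψ x e := by
    intro t; funext X q
    by_cases h : q.1 = e
    · simp only [ψ, h, if_true]
    · simp only [ψ, h, if_false, coords]
      rw [update_of_ne h]
  have hQ : ∀ t : Matrix.specialUnitaryGroup (Fin 2) ℂ,
      ((matrixConfig (fundamentalRep (Fin 2)) (update x e t) : MatrixConfig 3 L (fundamentalLatticeRep 2).N) e) =
        (t : Matrix (Fin 2) (Fin 2) ℂ) := by
    intro t
    show fundamentalRep (Fin 2) ((update x e t) e) = _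
    rw [update_self]; rfl
  have hut : ∀ t : Matrix.specialUnitaryGroup (Fin 2) ℂ, (g ∘ ψ x e) (t : Matrix (Fin 2) (Fin 2) ℂ) = g (coords (update x e t)) := by
    intro t
    have h1 := hψQ (update x e t)
    rw [hψupd t, hQ t] at h1
    show g (ψ x e (t : Matrix (Fin 2) (Fin 2) ℂ)) = g (coords (update x e t))
    rw [h1]
  have huC1 : ContDiff ℝ 1 (g ∘ ψ x e) := by
    have : ψ x e = fun X => T X + (coords x -
        T ((matrixConfig (fundamentalRep (Fin 2)) x : MatrixConfig 3 L (fundamentalLatticeRep 2).N) e)) := funext (hψT x)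
    rw [this]
    exact hg.comp (T.contDiff.add contDiff_const)
  have hLS := SUNBakryEmery.logSobolev_haar_of_contDiff_one (N := 2) two_ne_zero huC1
  have e1 : ∀ t : Matrix.specialUnitaryGroup (Fin 2) ℂ,
      (g ∘ ψ x e) (t : Matrix (Fin 2) (Fin 2) ℂ) ^ 2 = g (coords (update x e t)) ^ 2 := fun t => by rw [hut]
  have e2 : ∀ t : Matrix.specialUnitaryGroup (Fin 2) ℂ,
      SUNBakryEmery.Gam (g ∘ ψ x e) (g ∘ ψ x e) (t : Matrix (Fin 2) (Fin 2) ℂ) =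
        SUNBakryEmery.Gam (g ∘ ψ (update x e t) e) (g ∘ ψ (update x e t) e)
          ((matrixConfig (fundamentalRep (Fin 2)) (update x e t) : MatrixConfig 3 L (fundamentalLatticeRep 2).N) e) := by
    intro t; rw [hψupd t, hQ t]
  have h4 : (4 : ℝ) / ((2 : ℕ) : ℝ) = 2 := by norm_num
  simp only [e1, h4] at hLS
  refine hLS.trans (le_of_eq ?_)
  congr 1
  exact integral_congr_ae (ae_of_all _ e2)

/-! ## §3. The log-Sobolev inequality for product Haar measure in the carré-du-champ form -/

open scoped Matrix.Norms.Frobenius in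
/-- ★ **`Ent_{μ₀}((g∘coords)²) ≤ ∫ Γ_CSU(g,g) dμ₀`** for product Haar measure `μ₀ = wilsonMeasure 0` on `SU(2)^E` and every `C¹`
function `g` of the real link coordinates, `Γ_CSU(g,g) = Σ_{ij} ∂_i g ∂_j g (σσᵀ)_{ij}` the carré du champ of the SZZ coordinate
generator.  Tensorisation (`EntropyFlow.entropy_pi_le_of_nonneg`) of the per-link inequalities (`entropy_sq_link_le`), resampling
invariance (`EntropyFlow.integral_integral_update`) and the one-link dictionary (`carre_eq_two_mul_sum_Gam`).
[cite: BakryGentilLedoux2014, Prop. 5.2.7 and Prop. 5.7.1] -/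
theorem haar_entropy_sq_le_integral_carre (L : ℕ) [NeZero L] {g : (Edge 3 L × Fin 2 × Fin 2 × Bool → ℝ) → ℝ}
    (hg : ContDiff ℝ 1 g) :
    let coords : GaugeConfig 3 L (Matrix.specialUnitaryGroup (Fin 2) ℂ) → (Edge 3 L × Fin 2 × Fin 2 × Bool → ℝ) :=
      fun V q => (fun z : ℂ => if q.2.2.2 then z.im else z.re)
        ((fundamentalRep (Fin 2) (V q.1) : Matrix (Fin 2) (Fin 2) ℂ) q.2.1 q.2.2.1)
    let A : GaugeConfig 3 L (Matrix.specialUnitaryGroup (Fin 2) ℂ) → (Edge 3 L × Fin 2 × Fin 2 × Bool) →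
        (Edge 3 L × Fin 2 × Fin 2 × Bool) → ℝ := fun V i j =>
      ∑ n : Edge 3 L × NoiseIdx 2,
        (if n.1 = i.1 then (fun z : ℂ => if i.2.2.2 then z.im else z.re)
          ((latticeLangevinDynamics (fundamentalLatticeRep 2) 0).noise
            (matrixConfig (fundamentalRep (Fin 2)) V) i.1 n.2 i.2.1 i.2.2.1) else 0) *
        (if n.1 = j.1 then (fun z : ℂ => if j.2.2.2 then z.im else z.re)
          ((latticeLangevinDynamics (fundamentalLatticeRep 2) 0).noise
            (matrixConfig (fundamentalRep (Fin 2)) V) j.1 n.2 j.2.1 j.2.2.1) else 0)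
    (∫ V, g (coords V) ^ 2 * Real.log (g (coords V) ^ 2) ∂(wilsonMeasure (d := 3) (L := L) (fundamentalRep (Fin 2)) 0)) -
        (∫ V, g (coords V) ^ 2 ∂(wilsonMeasure (d := 3) (L := L) (fundamentalRep (Fin 2)) 0)) *
          Real.log (∫ V, g (coords V) ^ 2 ∂(wilsonMeasure (d := 3) (L := L) (fundamentalRep (Fin 2)) 0)) ≤
      ∫ V, ∑ i : Edge 3 L × Fin 2 × Fin 2 × Bool, ∑ j : Edge 3 L × Fin 2 × Fin 2 × Bool,
        fderiv ℝ g (coords V) (Pi.single i 1) * fderiv ℝ g (coords V) (Pi.single j 1) * A V i j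
        ∂(wilsonMeasure (d := 3) (L := L) (fundamentalRep (Fin 2)) 0) := by
  intro coords A
  classical
  haveI := secondCountableTopology_su2
  haveI := borelSpace_config L
  set σ : Measure (Matrix.specialUnitaryGroup (Fin 2) ℂ) := haarProbability (Matrix.specialUnitaryGroup (Fin 2) ℂ) with hσ
  haveI hσP : IsProbabilityMeasure σ := by rw [hσ]; infer_instance
  have hμ₀ : wilsonMeasure (d := 3) (L := L) (fundamentalRep (Fin 2)) 0 = Measure.pi fun _ : Edge 3 L => σ :=
    wilsonMeasure_zero_eq_pi
  rw [hμ₀]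
  haveI : IsProbabilityMeasure (Measure.pi fun _ : Edge 3 L => σ) := inferInstance
  let ψ : GaugeConfig 3 L (Matrix.specialUnitaryGroup (Fin 2) ℂ) → Edge 3 L →
      Matrix (Fin (fundamentalLatticeRep 2).N) (Fin (fundamentalLatticeRep 2).N) ℂ → (Edge 3 L × Fin 2 × Fin 2 × Bool → ℝ) :=
    fun V e X q => if q.1 = e then (fun z : ℂ => if q.2.2.2 then z.im else z.re) (X q.2.1 q.2.2.1) else coords V q
  set H : Edge 3 L → GaugeConfig 3 L (Matrix.specialUnitaryGroup (Fin 2) ℂ) → ℝ := fun e V =>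
    SUNBakryEmery.Gam (g ∘ ψ V e) (g ∘ ψ V e)
      ((matrixConfig (fundamentalRep (Fin 2)) V : MatrixConfig 3 L (fundamentalLatticeRep 2).N) e) with hH
  have hco : Continuous coords := continuous_coords (L := L)
  -- (i) the dictionary `Γ = 2 Σ_e H e`
  have hdict : ∀ V, (∑ i : Edge 3 L × Fin 2 × Fin 2 × Bool, ∑ j : Edge 3 L × Fin 2 × Fin 2 × Bool,
      fderiv ℝ g (coords V) (Pi.single i 1) * fderiv ℝ g (coords V) (Pi.single j 1) * A V i j) = 2 * ∑ e, H e V :=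
    fun V => carre_eq_two_mul_sum_Gam L 0 g (hg.differentiable one_ne_zero) V
  -- (ii) `H e` is continuous (chain rule through the affine chart) and non-negative
  have hHc : ∀ e, Continuous (H e) := by
    intro e
    obtain ⟨T, hψT', hψQ'⟩ := exists_linkChart_linear L e
    have hψT : ∀ (V : GaugeConfig 3 L (Matrix.specialUnitaryGroup (Fin 2) ℂ)) X, ψ V e X = T X + (coords V -
        T ((matrixConfig (fundamentalRep (Fin 2)) V : MatrixConfig 3 L (fundamentalLatticeRep 2).N) e)) := hψT'
    have hψQ : ∀ V : GaugeConfig 3 L (Matrix.specialUnitaryGroup (Fin 2) ℂ),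
        ψ V e ((matrixConfig (fundamentalRep (Fin 2)) V : MatrixConfig 3 L (fundamentalLatticeRep 2).N) e) = coords V := hψQ'
    have hchain : ∀ (V : GaugeConfig 3 L (Matrix.specialUnitaryGroup (Fin 2) ℂ)) (X : Matrix (Fin (fundamentalLatticeRep 2).N)
        (Fin (fundamentalLatticeRep 2).N) ℂ),
        fderiv ℝ (g ∘ ψ V e) ((matrixConfig (fundamentalRep (Fin 2)) V : MatrixConfig 3 L (fundamentalLatticeRep 2).N) e) X =
          fderiv ℝ g (coords V) (T X) := by
      intro V X
      have hψd : HasFDerivAt (ψ V e) T ((matrixConfig (fundamentalRep (Fin 2)) V : MatrixConfig 3 L (fundamentalLatticeRep 2).N) e) := by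
        have : ψ V e = fun Y => T Y + (coords V -
            T ((matrixConfig (fundamentalRep (Fin 2)) V : MatrixConfig 3 L (fundamentalLatticeRep 2).N) e)) := funext (hψT V)
        rw [this]
        exact T.hasFDerivAt.add_const _
      have hgd : HasFDerivAt g (fderiv ℝ g (coords V)) (ψ V e
          ((matrixConfig (fundamentalRep (Fin 2)) V : MatrixConfig 3 L (fundamentalLatticeRep 2).N) e)) := by
        rw [hψQ V]; exact ((hg.differentiable one_ne_zero) _).hasFDerivAt
      exact DFunLike.congr_fun ((hgd.comp _ hψd).fderiv) X
    have hform : ∀ V, H e V = ∑ α : SUNBakryEmery.FrameIdx (fundamentalLatticeRep 2).N,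
        fderiv ℝ g (coords V) (T (((matrixConfig (fundamentalRep (Fin 2)) V : MatrixConfig 3 L (fundamentalLatticeRep 2).N) e) *
          SUNBakryEmery.frame α)) *
        fderiv ℝ g (coords V) (T (((matrixConfig (fundamentalRep (Fin 2)) V : MatrixConfig 3 L (fundamentalLatticeRep 2).N) e) *
          SUNBakryEmery.frame α)) := by
      intro V
      show ∑ α : SUNBakryEmery.FrameIdx (fundamentalLatticeRep 2).N,
          SUNBakryEmery.matD (SUNBakryEmery.frame α) (g ∘ ψ V e)
              ((matrixConfig (fundamentalRep (Fin 2)) V : MatrixConfig 3 L (fundamentalLatticeRep 2).N) e) *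
            SUNBakryEmery.matD (SUNBakryEmery.frame α) (g ∘ ψ V e)
              ((matrixConfig (fundamentalRep (Fin 2)) V : MatrixConfig 3 L (fundamentalLatticeRep 2).N) e) = _
      exact Finset.sum_congr rfl fun α _ => congrArg₂ (· * ·) (hchain V _) (hchain V _)
    have hQc : Continuous fun V : GaugeConfig 3 L (Matrix.specialUnitaryGroup (Fin 2) ℂ) =>
        ((matrixConfig (fundamentalRep (Fin 2)) V : MatrixConfig 3 L (fundamentalLatticeRep 2).N) e) :=
      (continuous_fundamentalRep (n := Fin 2)).comp (continuous_apply e)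
    have hdg : Continuous (fderiv ℝ g) := hg.continuous_fderiv one_ne_zero
    have hsum : Continuous fun V => ∑ α : SUNBakryEmery.FrameIdx (fundamentalLatticeRep 2).N,
        fderiv ℝ g (coords V) (T (((matrixConfig (fundamentalRep (Fin 2)) V : MatrixConfig 3 L (fundamentalLatticeRep 2).N) e) *
          SUNBakryEmery.frame α)) *
        fderiv ℝ g (coords V) (T (((matrixConfig (fundamentalRep (Fin 2)) V : MatrixConfig 3 L (fundamentalLatticeRep 2).N) e) *
          SUNBakryEmery.frame α)) := by
      refine continuous_finsetSum _ fun α _ => ?_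
      have h1 : Continuous fun V : GaugeConfig 3 L (Matrix.specialUnitaryGroup (Fin 2) ℂ) =>
          fderiv ℝ g (coords V) (T (((matrixConfig (fundamentalRep (Fin 2)) V : MatrixConfig 3 L (fundamentalLatticeRep 2).N) e) *
            SUNBakryEmery.frame α)) :=
        (hdg.comp hco).clm_apply (T.continuous.comp (hQc.mul continuous_const))
      exact h1.mul h1
    exact hsum.congr fun V => (hform V).symm
  have hH0 : ∀ e V, 0 ≤ H e V := fun e V => Finset.sum_nonneg fun α _ => mul_self_nonneg _
  have hHi : ∀ e, Integrable (H e) (Measure.pi fun _ : Edge 3 L => σ) := fun e =>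
    integrable_of_continuous_of_compactSpace (hHc e) _
  -- (iii) `G² = (g∘coords)²` is continuous, hence bounded measurable, and non-negative
  have hGc : Continuous fun V => g (coords V) ^ 2 := (hg.continuous.comp hco).pow 2
  obtain ⟨M, -, hM⟩ := exists_abs_le_of_continuous_of_compactSpace hGc
  have hGm : Measurable fun V => g (coords V) ^ 2 := hGc.measurable
  have hGM : ∀ V, g (coords V) ^ 2 ≤ M := fun V => (le_abs_self _).trans (hM V)
  have h1 := EntropyFlow.entropy_pi_le_of_nonneg (fun _ : Edge 3 L => σ) (f := fun V => g (coords V) ^ 2) hGm (fun V => sq_nonneg _) hGM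
  refine h1.trans ?_
  -- (v) per link: `∫ Ent_e dπ ≤ ∫ 2 ∫ H e (update x e t) dσ dπ = 2 ∫ H e dπ`
  have h2 : ∀ e, ∫ x, ((∫ t, g (coords (update x e t)) ^ 2 * Real.log (g (coords (update x e t)) ^ 2) ∂σ) -
        (∫ t, g (coords (update x e t)) ^ 2 ∂σ) * Real.log (∫ t, g (coords (update x e t)) ^ 2 ∂σ)) ∂Measure.pi (fun _ : Edge 3 L => σ) ≤
      2 * ∫ V, H e V ∂Measure.pi (fun _ : Edge 3 L => σ) := by
    intro e
    have hpt : ∀ x, ((∫ t, g (coords (update x e t)) ^ 2 * Real.log (g (coords (update x e t)) ^ 2) ∂σ) -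
          (∫ t, g (coords (update x e t)) ^ 2 ∂σ) * Real.log (∫ t, g (coords (update x e t)) ^ 2 ∂σ)) ≤
        2 * ∫ t, H e (update x e t) ∂σ := fun x => entropy_sq_link_le L hg x e
    have hnn : ∀ x, 0 ≤ ((∫ t, g (coords (update x e t)) ^ 2 * Real.log (g (coords (update x e t)) ^ 2) ∂σ) -
          (∫ t, g (coords (update x e t)) ^ 2 ∂σ) * Real.log (∫ t, g (coords (update x e t)) ^ 2 ∂σ)) := by
      intro x
      have hc : Continuous fun t : Matrix.specialUnitaryGroup (Fin 2) ℂ => g (coords (update x e t)) ^ 2 :=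
        hGc.comp (continuous_const.update e continuous_id)
      have hcl : Continuous fun t : Matrix.specialUnitaryGroup (Fin 2) ℂ =>
          g (coords (update x e t)) ^ 2 * Real.log (g (coords (update x e t)) ^ 2) := Real.continuous_mul_log.comp hc
      exact entropy_nonneg σ (fun t => sq_nonneg _) (integrable_of_continuous_of_compactSpace hc σ)
        (integrable_of_continuous_of_compactSpace hcl σ)
    have hIi : Integrable (fun x => 2 * ∫ t, H e (update x e t) ∂σ) (Measure.pi fun _ : Edge 3 L => σ) := by
      obtain ⟨B, -, hB⟩ := exists_abs_le_of_continuous_of_compactSpace (hHc e)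
      refine (EntropyFlow.integrable_of_abs_le (Measure.pi fun _ : Edge 3 L => σ)
        (EntropyFlow.measurable_integral_update (fun _ : Edge 3 L => σ) e (hHc e).measurable) (B := B) fun x =>
          EntropyFlow.abs_integral_le_of_abs_le σ fun t => hB _).const_mul 2
    calc _ ≤ ∫ x, 2 * ∫ t, H e (update x e t) ∂σ ∂Measure.pi (fun _ : Edge 3 L => σ) :=
          integral_mono_of_nonneg (ae_of_all _ hnn) hIi (ae_of_all _ hpt)
      _ = 2 * ∫ V, H e V ∂Measure.pi (fun _ : Edge 3 L => σ) := by
          rw [integral_const_mul, EntropyFlow.integral_integral_update (fun _ : Edge 3 L => σ) e (hHi e)]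
  -- (vi) sum over links and the dictionary
  calc _ ≤ ∑ e, 2 * ∫ V, H e V ∂Measure.pi (fun _ : Edge 3 L => σ) := Finset.sum_le_sum fun e _ => h2 e
    _ = ∫ V, 2 * ∑ e, H e V ∂Measure.pi (fun _ : Edge 3 L => σ) := by
        rw [integral_const_mul, integral_finsetSum _ fun e _ => hHi e, Finset.mul_sum]
    _ = _ := integral_congr_ae (ae_of_all _ fun V => (hdict V).symm)

/-! ## §4. ★★ The generator-form log-Sobolev inequality for product Haar measure (`β' = 0`, constant `1/2`) -/

/-- ★★ **Log-Sobolev inequality for product Haar measure on `SU(2)^E`, generator form, constant `1/2`.**  For every `C³` function `f`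
of the real link coordinates, with `F = f∘coords`, `μ₀ = wilsonMeasure 0` (`= Haar^{⊗E}`) and `𝓛₀` the SZZ coordinate generator at `β' = 0`:
`(1/2)·(∫ F² log F² dμ₀ − (∫ F² dμ₀) log(∫ F² dμ₀)) ≤ −∫ F·𝓛₀f dμ₀`.  (Localise `f` by a bump `≡ 1` near the range of `coords`;
`haar_entropy_sq_le_integral_carre` + the energy identity `2∫ G 𝓛₀g dμ₀ = −∫ Γ(g,g) dμ₀`.)  This is the hypothesis `hLSgen` of
`entropy_transition_le_exp_of_generatorLogSobolev` / `klDiv_map_le_exp_of_generatorLogSobolev` at `β' = 0` with `ρ = 1/2`.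
[cite: BakryGentilLedoux2014, Prop. 5.2.7 and Prop. 5.7.1] [cite: ShenZhuZhuCMP2023, Cor. 4.4 (4.11), β = 0] -/
theorem haar_generatorLogSobolev (L : ℕ) [NeZero L]
    (f : (Edge 3 L × Fin 2 × Fin 2 × Bool → ℝ) → ℝ) (hf : ContDiff ℝ 3 f) :
    let coords : GaugeConfig 3 L (Matrix.specialUnitaryGroup (Fin 2) ℂ) → (Edge 3 L × Fin 2 × Fin 2 × Bool → ℝ) :=
      fun V q => (fun z : ℂ => if q.2.2.2 then z.im else z.re)
        ((fundamentalRep (Fin 2) (V q.1) : Matrix (Fin 2) (Fin 2) ℂ) q.2.1 q.2.2.1)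
    let gen : GaugeConfig 3 L (Matrix.specialUnitaryGroup (Fin 2) ℂ) → ℝ := fun V =>
      (∑ i : Edge 3 L × Fin 2 × Fin 2 × Bool, fderiv ℝ f (coords V) (Pi.single i 1) *
          (fun z : ℂ => if i.2.2.2 then z.im else z.re)
            ((latticeLangevinDynamics (fundamentalLatticeRep 2) 0).drift
              (matrixConfig (fundamentalRep (Fin 2)) V) i.1 i.2.1 i.2.2.1) +
      1 / 2 * ∑ i : Edge 3 L × Fin 2 × Fin 2 × Bool, ∑ j : Edge 3 L × Fin 2 × Fin 2 × Bool,
        fderiv ℝ (fun z => fderiv ℝ f z (Pi.single i 1)) (coords V) (Pi.single j 1) *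
          ∑ n : Edge 3 L × NoiseIdx 2,
            (if n.1 = i.1 then (fun z : ℂ => if i.2.2.2 then z.im else z.re)
              ((latticeLangevinDynamics (fundamentalLatticeRep 2) 0).noise
                (matrixConfig (fundamentalRep (Fin 2)) V) i.1 n.2 i.2.1 i.2.2.1) else 0) *
            (if n.1 = j.1 then (fun z : ℂ => if j.2.2.2 then z.im else z.re)
              ((latticeLangevinDynamics (fundamentalLatticeRep 2) 0).noise
                (matrixConfig (fundamentalRep (Fin 2)) V) j.1 n.2 j.2.1 j.2.2.1) else 0))
    (1 / 2 : ℝ) * ((∫ V, f (coords V) ^ 2 * Real.log (f (coords V) ^ 2) ∂(wilsonMeasure (d := 3) (L := L) (fundamentalRep (Fin 2)) 0)) -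
        (∫ V, f (coords V) ^ 2 ∂(wilsonMeasure (d := 3) (L := L) (fundamentalRep (Fin 2)) 0)) *
          Real.log (∫ V, f (coords V) ^ 2 ∂(wilsonMeasure (d := 3) (L := L) (fundamentalRep (Fin 2)) 0))) ≤
      -∫ V, f (coords V) * gen V ∂(wilsonMeasure (d := 3) (L := L) (fundamentalRep (Fin 2)) 0) := by
  intro coords gen
  classical
  haveI := secondCountableTopology_su2
  haveI := borelSpace_config L
  set μ : Measure (GaugeConfig 3 L (Matrix.specialUnitaryGroup (Fin 2) ℂ)) :=
    wilsonMeasure (d := 3) (L := L) (fundamentalRep (Fin 2)) 0 with hμ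
  -- localisation: `g = χ·f`, compactly supported, `= f` on a ball containing the range of `coords`
  let χ : ContDiffBump (0 : (Edge 3 L × Fin 2 × Fin 2 × Bool) → ℝ) := ⟨2, 3, by norm_num, by norm_num⟩
  set g : ((Edge 3 L × Fin 2 × Fin 2 × Bool) → ℝ) → ℝ := fun y =>
    (χ : ((Edge 3 L × Fin 2 × Fin 2 × Bool) → ℝ) → ℝ) y * f y with hgdef
  have hg : ContDiff ℝ 3 g := χ.contDiff.mul hf
  have hgc : HasCompactSupport g := χ.hasCompactSupport.mul_right
  have hball : ∀ V : GaugeConfig 3 L (Matrix.specialUnitaryGroup (Fin 2) ℂ),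
      coords V ∈ ball (0 : (Edge 3 L × Fin 2 × Fin 2 × Bool) → ℝ) 2 := by
    intro V
    rw [mem_ball, dist_zero_right]
    exact (norm_coords_le_one V).trans_lt (by norm_num)
  have hEq : ∀ y ∈ ball (0 : (Edge 3 L × Fin 2 × Fin 2 × Bool) → ℝ) 2, g y = f y + 0 := by
    intro y hy
    have h1 : (χ : ((Edge 3 L × Fin 2 × Fin 2 × Bool) → ℝ) → ℝ) y = 1 :=
      χ.one_of_mem_closedBall (ball_subset_closedBall hy)
    simp only [hgdef, h1, one_mul, add_zero]
  have hgF : ∀ V, g (coords V) = f (coords V) := fun V => by rw [hEq _ (hball V), add_zero]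
  have hfd : ∀ V, fderiv ℝ g (coords V) = fderiv ℝ f (coords V) := fun V => fderiv_eq_of_eqOn_ball hEq (hball V)
  have hfd2 : ∀ V (v : (Edge 3 L × Fin 2 × Fin 2 × Bool) → ℝ),
      fderiv ℝ (fun z => fderiv ℝ g z v) (coords V) = fderiv ℝ (fun z => fderiv ℝ f z v) (coords V) := fun V v =>
    fderiv_fderiv_eq_of_eqOn_ball hEq (hball V) v
  set A : GaugeConfig 3 L (Matrix.specialUnitaryGroup (Fin 2) ℂ) → (Edge 3 L × Fin 2 × Fin 2 × Bool) →
      (Edge 3 L × Fin 2 × Fin 2 × Bool) → ℝ := fun V i j =>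
    ∑ n : Edge 3 L × NoiseIdx 2,
      (if n.1 = i.1 then (fun z : ℂ => if i.2.2.2 then z.im else z.re)
        ((latticeLangevinDynamics (fundamentalLatticeRep 2) 0).noise
          (matrixConfig (fundamentalRep (Fin 2)) V) i.1 n.2 i.2.1 i.2.2.1) else 0) *
      (if n.1 = j.1 then (fun z : ℂ => if j.2.2.2 then z.im else z.re)
        ((latticeLangevinDynamics (fundamentalLatticeRep 2) 0).noise
          (matrixConfig (fundamentalRep (Fin 2)) V) j.1 n.2 j.2.1 j.2.2.1) else 0) with hA
  set geng : GaugeConfig 3 L (Matrix.specialUnitaryGroup (Fin 2) ℂ) → ℝ := fun V =>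
    (∑ i : Edge 3 L × Fin 2 × Fin 2 × Bool, fderiv ℝ g (coords V) (Pi.single i 1) *
        (fun z : ℂ => if i.2.2.2 then z.im else z.re)
          ((latticeLangevinDynamics (fundamentalLatticeRep 2) 0).drift
            (matrixConfig (fundamentalRep (Fin 2)) V) i.1 i.2.1 i.2.2.1) +
    1 / 2 * ∑ i : Edge 3 L × Fin 2 × Fin 2 × Bool, ∑ j : Edge 3 L × Fin 2 × Fin 2 × Bool,
      fderiv ℝ (fun z => fderiv ℝ g z (Pi.single i 1)) (coords V) (Pi.single j 1) * A V i j) with hgengdef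
  have hgen : ∀ V, geng V = gen V := by
    intro V
    simp only [hgengdef, gen, hA, hfd V, hfd2 V]
  have hcarre : 2 * ∫ V, g (coords V) * geng V ∂μ =
      -∫ V, (∑ i : Edge 3 L × Fin 2 × Fin 2 × Bool, ∑ j : Edge 3 L × Fin 2 × Fin 2 × Bool,
        fderiv ℝ g (coords V) (Pi.single i 1) * fderiv ℝ g (coords V) (Pi.single j 1) * A V i j) ∂μ :=
    two_mul_integral_mul_generator_eq_neg_carre L 0 hg hgc
  have hLS := haar_entropy_sq_le_integral_carre L (hg.of_le (by norm_num))
  rw [← hμ] at hLS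
  have e1 : ∫ V, f (coords V) ^ 2 * Real.log (f (coords V) ^ 2) ∂μ = ∫ V, g (coords V) ^ 2 * Real.log (g (coords V) ^ 2) ∂μ := by
    simp only [hgF]
  have e2 : ∫ V, f (coords V) ^ 2 ∂μ = ∫ V, g (coords V) ^ 2 ∂μ := by simp only [hgF]
  have e3 : ∫ V, f (coords V) * gen V ∂μ = ∫ V, g (coords V) * geng V ∂μ := by simp only [hgF, hgen]
  rw [e1, e2, e3]
  linarith [hLS, hcarre]

end Summit.QuantumFields.YangMills.Theorems.ColdStartUniversality

end
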